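import Summits.KontsevichZagierPeriods.KontsevichZagierPeriods.Theses.SymplecticScissors
import Literature.NumberTheory.Transcendental.BakerCoefficientForm
import Summits.KontsevichZagierPeriods.KontsevichZagierPeriods.Theorems.InverseLandauTateLiftingBakerDecomposition

/-!
# `TypeAGeneration` (stmt-KontsevichZagierPeriods-18392), line `Sketch`, stub `stub_bakerSplit` (B1):
the Baker split of a vanishing `β + Σ cⱼ lⱼ`

Registered stub `stub_bakerSplit` of the crux `TypeAGeneration` (route SymplecticScissors, line
`Sketch` = card stokes-compiler), Layer 1 (one-variable rational integrands): the vanishing of the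
number `β + Σⱼ cⱼ lⱼ` (`β, cⱼ ∈ ℚ̄`, `e^{lⱼ} ∈ ℚ̄`, any determinations `lⱼ` of the logarithms) is
converted into EXACT data — `β = 0`, and the coefficient vector `c` is a `ℚ̄`-linear combination
of INTEGER relation vectors `E_t ∈ ℤ^m` with `Σⱼ E_t j lⱼ = 0` exactly.

Proof (Baker's Theorem 2.1 WITH `1`, sorry-free in the tree as
`Literature.NumberTheory.Transcendental.baker_coeff_eq_zero`, plus `ℚ`-linear algebra in `ℂ`,
run exactly as the tree's real-logarithm decomposition
`Summit.KontsevichZagierPeriods.InverseLandau.tateLifting_bakerDecomposition`, whose folklore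
helpers `tateLifting_exists_finset_linearIndependent` (a maximal `ℚ`-independent subfamily
spanning the family) and `tateLifting_exists_int_mul_eq` (common denominator) are imported and
reused):

1. a maximal `ℚ`-linearly independent subfamily `(l_j)_{j ∈ J}` and rational coordinates
   `ρ i j` (`j ∈ J`, zero off `J`) with `l i = Σ_j ρ i j • l j`;
2. substituting, `β + Σ_{j ∈ J} (Σ_i c_i ρ i j) l_j = 0` with algebraic coefficients, so Baker's
   Theorem 2.1 in coefficient form gives `β = 0` and every column sum `Σ_i c_i ρ i j = 0`;
3. a common denominator `D ≠ 0`, `n i j = D ρ i j ∈ ℤ`, gives the `m` integer relations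
   `E_i = D e_i − Σ_j n i j e_j` (`Σ_k E_i k l_k = D (l_i − Σ_j ρ i j l_j) = 0`), and
   `c = Σ_i (c_i / D) E_i` is the column-sum identity of step 2.

Reference: A. Baker, *Transcendental Number Theory*, Cambridge Univ. Press (1975), Ch. 2,
Theorem 2.1.
-/

noncomputable section

-- `Summit.KontsevichZagierPeriods.KontsevichZagierPeriods.…` is the tree's mandated layout (single-conjunct summit).
set_option linter.dupNamespace false

namespace Summit.KontsevichZagierPeriods.KontsevichZagierPeriods.TypeAGenerationLine

open Literature.NumberTheory.Transcendental
open Summit.KontsevichZagierPeriods.InverseLandau (tateLifting_exists_finset_linearIndependent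
  tateLifting_exists_int_mul_eq)

/-- **Rational coordinates on a spanning subfamily.** If every `l i` lies in the `ℚ`-span of
`(l j)_{j ∈ J}`, there are rational coordinates `ρ i j`, vanishing for `j ∉ J`, with
`Σ_j ρ i j • l j = l i`. [folklore] -/
theorem b1_exists_rat_coords {m : ℕ} (l : Fin m → ℂ) (J : Finset (Fin m))
    (hJsp : ∀ i, l i ∈ Submodule.span ℚ (l '' ↑J)) :
    ∃ ρ : Fin m → Fin m → ℚ,
      (∀ i j, j ∉ J → ρ i j = 0) ∧ ∀ i, ∑ j, (ρ i j : ℂ) * l j = l i := by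
  classical
  have hcoef : ∀ i, ∃ q : Fin m → ℚ, ∑ j ∈ J, q j • l j = l i :=
    fun i => (Submodule.mem_span_image_finset_iff_exists_fun' ℚ).mp (hJsp i)
  choose q hq using hcoef
  refine ⟨fun i j => if j ∈ J then q i j else 0, fun i j hj => if_neg hj, fun i => ?_⟩
  calc ∑ j, ((if j ∈ J then q i j else 0 : ℚ) : ℂ) * l j
      = ∑ j ∈ J, ((if j ∈ J then q i j else 0 : ℚ) : ℂ) * l j :=
        (Finset.sum_subset (Finset.subset_univ J) fun j _ hj => by simp [hj]).symm
    _ = ∑ j ∈ J, q i j • l j := Finset.sum_congr rfl fun j hj => by simp [hj, Rat.smul_def]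
    _ = l i := hq i

/-- **B1 — the Baker split** (registered stub `stub_bakerSplit`). If `e^{lⱼ}` is algebraic for
every `j`, `β, cⱼ ∈ ℚ̄` and `β + Σⱼ cⱼ lⱼ = 0`, then `β = 0` and `c` is a `ℚ̄`-linear combination
of INTEGER relation vectors `E` with `Σⱼ Eⱼ lⱼ = 0` exactly: choose a maximal `ℚ`-linearly
independent subfamily of the `lⱼ`, expand the others over it with rational coefficients, apply
Baker's Theorem 2.1 in coefficient form (`baker_coeff_eq_zero`, sorry-free in the tree) to the
collected (algebraic) coefficients, and clear denominators. [cite: Baker1975, Theorem 2.1] -/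
theorem stub_bakerSplit :
    ∀ (m : ℕ) (l c : Fin m → ℂ) (β : ℂ),
      (∀ j, IsAlgebraic ℚ (Complex.exp (l j))) → (∀ j, IsAlgebraic ℚ (c j)) → IsAlgebraic ℚ β →
      β + ∑ j, c j * l j = 0 →
      β = 0 ∧ ∃ (r : ℕ) (lam : Fin r → ℂ) (E : Fin r → Fin m → ℤ),
        (∀ t, IsAlgebraic ℚ (lam t)) ∧ (∀ t, ∑ j, (E t j : ℂ) * l j = 0) ∧
        ∀ j, c j = ∑ t, lam t * (E t j : ℂ) := by
  intro m l c β hla hca hβa h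
  classical
  -- (1) a maximal `ℚ`-linearly independent subfamily `(l j)_{j ∈ J}`; rational coordinates `ρ`
  obtain ⟨J, hJli, hJsp⟩ : ∃ J : Finset (Fin m),
      LinearIndependent ℚ (fun j : J => l j) ∧ ∀ i, l i ∈ Submodule.span ℚ (l '' ↑J) :=
    tateLifting_exists_finset_linearIndependent ℚ l
  obtain ⟨ρ, hρJ, hρ⟩ := b1_exists_rat_coords l J hJsp
  -- (2) Baker: `β = 0` and every column sum `Σ_i c_i ρ_ij` vanishes
  have hσa : ∀ j, IsAlgebraic ℚ (∑ i, c i * (ρ i j : ℂ)) := fun j =>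
    mem_algebraicClosure_iff.mp (sum_mem fun i _ =>
      mul_mem (mem_algebraicClosure_iff.mpr (hca i)) (SubfieldClass.ratCast_mem _ _))
  have h1 : β + ∑ j : J, (∑ i, c i * (ρ i j : ℂ)) * l j = 0 := by
    have hzero : ∀ j ∈ (Finset.univ : Finset (Fin m)), j ∉ J →
        (∑ i, c i * (ρ i j : ℂ)) * l j = 0 := fun j _ hj => by simp [hρJ _ _ hj]
    have h2 : ∑ j, (∑ i, c i * (ρ i j : ℂ)) * l j = ∑ i, c i * l i := by
      calc ∑ j, (∑ i, c i * (ρ i j : ℂ)) * l j = ∑ i, c i * ∑ j, (ρ i j : ℂ) * l j := by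
            simp only [Finset.sum_mul, Finset.mul_sum, mul_assoc]
            exact Finset.sum_comm
        _ = ∑ i, c i * l i := by simp only [hρ]
    rw [Finset.sum_coe_sort J fun j => (∑ i, c i * (ρ i j : ℂ)) * l j,
      Finset.sum_subset (Finset.subset_univ J) hzero, h2]
    exact h
  obtain ⟨hβ0, hσJ⟩ := baker_coeff_eq_zero (fun j : J => l j) (fun j => hla j) hJli
    (β := fun j : J => ∑ i, c i * (ρ i j : ℂ)) hβa (fun j => hσa j) h1
  have hσ : ∀ j, ∑ i, c i * (ρ i j : ℂ) = 0 := fun j => by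
    by_cases hj : j ∈ J
    · exact hσJ ⟨j, hj⟩
    · simp [hρJ _ _ hj]
  refine ⟨hβ0, ?_⟩
  -- (3) clear denominators: `n i j = D ρ i j ∈ ℤ`
  obtain ⟨D, n, hD, hn⟩ := tateLifting_exists_int_mul_eq ρ
  have hD' : (D : ℂ) ≠ 0 := by exact_mod_cast hD
  have hn' : ∀ i j, ((n i j : ℤ) : ℂ) = (D : ℂ) * (ρ i j : ℂ) := fun i j => by
    exact_mod_cast hn i j
  -- (4) the relations `E_i = D e_i − Σ_j n_ij e_j` with coefficients `c_i / D`
  refine ⟨m, fun i => c i / D, fun i k => (if k = i then D else 0) - n i k, fun i => ?_,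
    fun i => ?_, fun k => ?_⟩
  · exact mem_algebraicClosure_iff.mp
      (div_mem (mem_algebraicClosure_iff.mpr (hca i)) (intCast_mem _ D))
  · calc ∑ k, (((if k = i then D else 0) - n i k : ℤ) : ℂ) * l k
        = D * l i - D * ∑ k, (ρ i k : ℂ) * l k := by
          simp only [Int.cast_sub, Int.cast_ite, Int.cast_zero, hn', sub_mul,
            Finset.sum_sub_distrib, ite_mul, zero_mul, Finset.sum_ite_eq', Finset.mem_univ,
            if_true, Finset.mul_sum, mul_assoc]
      _ = 0 := by rw [hρ i, sub_self]
  · symm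
    calc ∑ i, c i / D * (((if k = i then D else 0) - n i k : ℤ) : ℂ)
        = ∑ i, (if k = i then c i else 0) - ∑ i, c i * (ρ i k : ℂ) := by
          rw [← Finset.sum_sub_distrib]
          refine Finset.sum_congr rfl fun i _ => ?_
          rw [Int.cast_sub, Int.cast_ite, Int.cast_zero, hn', mul_sub, ← mul_assoc,
            div_mul_cancel₀ _ hD']
          split_ifs
          · rw [div_mul_cancel₀ _ hD']
          · rw [mul_zero]
      _ = c k := by rw [Finset.sum_ite_eq, if_pos (Finset.mem_univ _), hσ k, sub_zero]

end Summit.KontsevichZagierPeriods.KontsevichZagierPeriods.TypeAGenerationLine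

end
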